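import Mathlib.MeasureTheory.Integral.CircleIntegral
import Mathlib.Analysis.SpecialFunctions.PolarCoord
import Mathlib.Analysis.Complex.CauchyIntegral
import Mathlib.MeasureTheory.Integral.Prod
import Literature.Analysis.Complex.PolydiscWeightedMeanValue
import HarnessLib

/-!
# `∫_𝔻 H(|ζ|) ζ Ψ(ζ) dA = 0` for `Ψ` holomorphic on the unit disc and a radial weight `H`

[[cite: Shintani1975, §2, proof of Prop. 2.3 (p. 103)]] — in the unfolding of Shintani's theta
lift, the orbit of a DEFINITE lattice vector `x` contributes
`∫_ℍ φ(w) x(w,1) e^{-c p_w(x)²} dμ(w)`; moving the root of `x` to `i` and passing to the disc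
`ζ = (w - i)/(w + i)` this becomes `∫_𝔻 H(|ζ|) ζ Ψ(ζ) dA` with `Ψ = φ dw/dζ` holomorphic and `H`
radial, which vanishes: in polar coordinates the angular integral is
`∫ e^{iθ} Ψ(re^{iθ}) dθ = ∮_{|ζ|=r} Ψ dζ/(ir) = 0` by Cauchy's theorem (Shintani: "`∫₀^{2π}
e^{2iℓθ} dθ = 0`", p. 103).  This file PROVES the disc statement (Mathlib-only):

* `integral_circleMap_mul_eq_zero` — `∫_{-π}^{π} re^{iθ} Ψ(re^{iθ}) dθ = 0` for `0 ≤ r < 1`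
  (periodicity + `Complex.circleIntegral_eq_zero_of_differentiable_on_off_countable`);
* `integral_ball_eq_integral_polar` — the disc integral in polar coordinates
  (`Complex.integral_comp_polarCoord_symm`);
* **`integral_ball_radial_mul_eq_zero`** — `∫_{|ζ|<1} H(|ζ|) ζ Ψ(ζ) dA = 0` under integrability
  of the polar integrand (Fubini with `r` outermost).

No named facts, no definitions.
-/

noncomputable section

open Complex MeasureTheory Set Filter Real intervalIntegral
open scoped Topology

namespace Literature.NumberTheory.EllipticCurves.ModularForms

open Literature.Analysis.Complex (polarCoord_symm_eq_circleMap)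

/-- The angular integral of `ζ Ψ(ζ)` over the circle `|ζ| = r` is `∮ Ψ / i`; it vanishes for `Ψ`
holomorphic on a larger disc (Cauchy). [folklore] -/
theorem integral_circleMap_mul_eq_zero {Ψ : ℂ → ℂ} {r : ℝ} (hr : 0 ≤ r) (hr1 : r < 1)
    (hΨ : DifferentiableOn ℂ Ψ (Metric.ball 0 1)) :
    ∫ θ in (-π)..π, circleMap 0 r θ * Ψ (circleMap 0 r θ) = 0 := by
  -- shift to `[0, 2π]` by periodicity
  have hper : Function.Periodic (fun θ : ℝ ↦ circleMap 0 r θ * Ψ (circleMap 0 r θ)) (2 * π) := by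
    intro θ
    simp only [periodic_circleMap 0 r θ]
  have hshift := hper.intervalIntegral_add_eq (-π) 0
  rw [show -π + 2 * π = π by ring, zero_add] at hshift
  rw [hshift]
  -- Cauchy: `∮_{C(0,r)} Ψ = 0`
  have hC : (∮ z in C(0, r), Ψ z) = 0 := by
    refine Complex.circleIntegral_eq_zero_of_differentiable_on_off_countable hr (s := ∅)
      Set.countable_empty ?_ ?_
    · exact (hΨ.continuousOn).mono (Metric.closedBall_subset_ball (by simpa using hr1))
    · intro z hz
      rw [Set.sdiff_empty] at hz
      exact hΨ.differentiableAt (Metric.isOpen_ball.mem_nhds (Metric.ball_subset_ball hr1.le hz))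
  rw [circleIntegral] at hC
  simp only [deriv_circleMap] at hC
  -- `hC : ∫₀^{2π} (circleMap 0 r θ * I) • Ψ = 0`
  have : (∫ θ in (0 : ℝ)..2 * π, (circleMap 0 r θ * I) • Ψ (circleMap 0 r θ)) =
      I * ∫ θ in (0 : ℝ)..2 * π, circleMap 0 r θ * Ψ (circleMap 0 r θ) := by
    rw [← intervalIntegral.integral_const_mul]
    refine intervalIntegral.integral_congr fun θ _ ↦ ?_
    simp only [smul_eq_mul]; ring
  rw [this] at hC
  exact (mul_eq_zero.mp hC).resolve_left I_ne_zero

/-- **The disc integral in polar coordinates**: for any `F : ℂ → ℂ`,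
`∫_{|ζ|<1} F(ζ) dA = ∫∫_{(0,1)×(-π,π)} r F(re^{iθ}) dr dθ` (Mathlib's
`Complex.integral_comp_polarCoord_symm`; both sides `0` if not integrable). [folklore] -/
theorem integral_ball_eq_integral_polar (F : ℂ → ℂ) :
    ∫ ζ in Metric.ball (0 : ℂ) 1, F ζ =
      ∫ p in Ioo (0 : ℝ) 1 ×ˢ Ioo (-π) π, (p.1 : ℂ) * F (circleMap 0 p.1 p.2) := by
  rw [← MeasureTheory.integral_indicator Metric.isOpen_ball.measurableSet,
    ← Complex.integral_comp_polarCoord_symm]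
  have hsub : Ioo (0 : ℝ) 1 ×ˢ Ioo (-π) π ⊆ polarCoord.target := by
    rw [polarCoord_target]
    exact prod_mono Ioo_subset_Ioi_self le_rfl
  rw [← inter_eq_right.mpr hsub, ← setIntegral_indicator (measurableSet_Ioo.prod measurableSet_Ioo)]
  refine setIntegral_congr_fun polarCoord.open_target.measurableSet fun p hp ↦ ?_
  rw [polarCoord_target, mem_prod, mem_Ioi, mem_Ioo] at hp
  obtain ⟨hr, hθ1, hθ2⟩ := hp
  rw [polarCoord_symm_eq_circleMap]
  have hnorm : ‖circleMap 0 p.1 p.2‖ = p.1 := by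
    rw [circleMap_zero, norm_mul, Complex.norm_real, Complex.norm_exp_ofReal_mul_I, mul_one,
      Real.norm_of_nonneg hr.le]
  by_cases hmem : p ∈ Ioo (0 : ℝ) 1 ×ˢ Ioo (-π) π
  · rw [indicator_of_mem hmem]
    have hball : circleMap 0 p.1 p.2 ∈ Metric.ball (0 : ℂ) 1 := by
      rw [Metric.mem_ball, dist_zero_right, hnorm]; exact (mem_prod.mp hmem).1.2
    rw [indicator_of_mem hball, real_smul]
  · rw [indicator_of_notMem hmem]
    have hball : circleMap 0 p.1 p.2 ∉ Metric.ball (0 : ℂ) 1 := by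
      rw [Metric.mem_ball, dist_zero_right, hnorm]
      intro h1
      exact hmem (mem_prod.mpr ⟨⟨hr, h1⟩, hθ1, hθ2⟩)
    rw [indicator_of_notMem hball, smul_zero]

/-- **Vanishing of the disc integral of `H(|ζ|) ζ Ψ(ζ)`**: for `Ψ` holomorphic on the unit disc
and a radial weight `H`, under integrability of the polar integrand,
`∫_{|ζ|<1} H(|ζ|) ζ Ψ(ζ) dA = ∫₀¹ r² H(r) (∫_{-π}^{π} e^{iθ} Ψ(re^{iθ}) dθ) dr = 0`, the inner
integral being `∮_{|ζ|=r} Ψ dζ /(ir) = 0` by Cauchy's theorem. This is the mechanism behind the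
vanishing of the DEFINITE orbits in Shintani's lift (rotation around the fixed point of the form).
[cite: Shintani1975, §2, proof of Prop. 2.3 (p. 103)] -/
theorem integral_ball_radial_mul_eq_zero {Ψ : ℂ → ℂ} (hΨ : DifferentiableOn ℂ Ψ (Metric.ball 0 1))
    (H : ℝ → ℂ)
    (hint : IntegrableOn (fun p : ℝ × ℝ ↦ (p.1 : ℂ) * (H p.1 * (circleMap 0 p.1 p.2 * Ψ (circleMap 0 p.1 p.2))))
      (Ioo (0 : ℝ) 1 ×ˢ Ioo (-π) π)) :
    ∫ ζ in Metric.ball (0 : ℂ) 1, H ‖ζ‖ * (ζ * Ψ ζ) = 0 := by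
  rw [integral_ball_eq_integral_polar]
  -- replace `H ‖re^{iθ}‖` by `H r` on the domain
  have hcongr : ∫ p in Ioo (0 : ℝ) 1 ×ˢ Ioo (-π) π, (p.1 : ℂ) * (H ‖circleMap 0 p.1 p.2‖ *
      (circleMap 0 p.1 p.2 * Ψ (circleMap 0 p.1 p.2))) =
      ∫ p in Ioo (0 : ℝ) 1 ×ˢ Ioo (-π) π, (p.1 : ℂ) * (H p.1 * (circleMap 0 p.1 p.2 * Ψ (circleMap 0 p.1 p.2))) := by
    refine setIntegral_congr_fun (measurableSet_Ioo.prod measurableSet_Ioo) fun p hp ↦ ?_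
    have hr : 0 < p.1 := (mem_prod.mp hp).1.1
    have hn : ‖circleMap 0 p.1 p.2‖ = p.1 := by
      rw [circleMap_zero, norm_mul, Complex.norm_real, Complex.norm_exp_ofReal_mul_I, mul_one,
        Real.norm_of_nonneg hr.le]
    rw [hn]
  rw [hcongr]
  -- Fubini, `r` outermost
  have hvol : (volume : Measure (ℝ × ℝ)).restrict (Ioo (0 : ℝ) 1 ×ˢ Ioo (-π) π) =
      (volume.restrict (Ioo (0 : ℝ) 1)).prod (volume.restrict (Ioo (-π) π)) := by
    rw [Measure.prod_restrict, ← Measure.volume_eq_prod]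
  have hint' : Integrable (fun p : ℝ × ℝ ↦ (p.1 : ℂ) * (H p.1 * (circleMap 0 p.1 p.2 * Ψ (circleMap 0 p.1 p.2))))
      ((volume.restrict (Ioo (0 : ℝ) 1)).prod (volume.restrict (Ioo (-π) π))) := by
    rw [← hvol]; exact hint
  rw [hvol, integral_prod _ hint']
  refine integral_eq_zero_of_ae ((ae_restrict_iff' measurableSet_Ioo).mpr (Eventually.of_forall fun r hr ↦ ?_))
  have h0 := integral_circleMap_mul_eq_zero hr.1.le hr.2 hΨ
  rw [intervalIntegral.integral_of_le (by linarith [pi_pos]), integral_Ioc_eq_integral_Ioo] at h0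
  calc ∫ θ in Ioo (-π) π, (r : ℂ) * (H r * (circleMap 0 r θ * Ψ (circleMap 0 r θ)))
      = (r : ℂ) * H r * ∫ θ in Ioo (-π) π, circleMap 0 r θ * Ψ (circleMap 0 r θ) := by
        rw [← MeasureTheory.integral_const_mul]
        refine integral_congr_ae (Eventually.of_forall fun θ ↦ ?_)
        simp only; ring
    _ = 0 := by rw [h0, mul_zero]

end Literature.NumberTheory.EllipticCurves.ModularForms
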